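import Summits.RiemannHypothesis.RiemannHypothesis.Theorems.TiltedLandingLaw421R3TouchedGlueHChild

/-! # TouchedGlueHChildAll-v1 — the CHOOSE-FREE corollary of 41d (#1211 `…R3TouchedGlueHChild`) over ALL β-witness pairs (lens-2 g9 O10-c(ii); ONE TREE import)
Hands' read on 41d (desk g31 l.8464, crit-1 g6 HANDS-91): the children hypotheses `h₁/h₂/hcarry` of `touchEnergyQ_le_heldEnergyQ_of_children` /
`touchRiseHQ_eq_penalty_of_children` live on the CHOSEN witness pair `Classical.choose hk`, so an instrument must certify them for the pair Lean chooses.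
This file gives the form an instrument CAN certify: the same data for EVERY β-witness pair `p` at level `k` (`ChildrenCarryAll`), specialised inside the
proof to the chosen one by `Classical.choose_spec`.  (K) bookkeeping only; no law; the geometric half of (M1) — that the children EXIST inside `Ū(p)` — is
NOT here (it overlaps the K-2 chain `…R3BudgetBox*` / `…R3LightIsolatedChild` Newton-disc machinery and is left to it).  Nothing here bears on RH; RH is not proved. -/

namespace RhW08.TouchedGlueHChildAll

open RhW08.Round1 RhW08.StSwap RhW08.Round2 RhW08.QuadW
open RhW08.SealSwap (PBot)
open RhW08.SealSwapQ RhW08.TouchedDissipation RhW08.TouchedDissipationW RhW08.TouchedGlueW RhW08.TouchedGlueH RhW08.TouchedGlueHChild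
open RhIdea6.G17.W07C7 RhIdea6.G17.W07C7.Rev6 RhIdea6.G18.W07C8.Law421BirthS RhIdea6.G19.W07C11.Seam
open RhIdea6.G20.W07C12.Frac RhIdea6.G20.W07C12.StColP RhW07.C12.FieldSplit RhW07.C14.TwoSided RhW07.C14.Classes

/-- the choose-free children datum at level `k`: EVERY β-witness pair `p` has two distinct level-`k` children inside `Ū(p)` carrying the level-`(k+1)` touch energy. -/
def ChildrenCarryAll (κ₀ η : ℝ) (f : ℂ → ℂ) (x₀ s hmax R Hs : ℝ) (B k : ℕ) : Prop :=
  ∀ p : ℂ × ℂ, BetaWitnessQ κ₀ η f x₀ s hmax R Hs B k p → ∃ u₁ u₂ : ℂ, u₁ ≠ u₂ ∧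
    u₁ ∈ childSupport f k (pairUnion p.1 p.2) ∧ u₂ ∈ childSupport f k (pairUnion p.1 p.2) ∧ touchEnergyQ η f x₀ s hmax R Hs B (k + 1) ≤ u₁.im ^ 2 + u₂.im ^ 2

/-- ★ (K) choose-free `touchEnergyQ_le_heldEnergyQ_of_children`: the all-pairs datum forces `touchEnergyQ (k+1) ≤ heldEnergyQ (k+1)` at a β-witness level `k`. -/
theorem touchEnergyQ_le_heldEnergyQ_of_all {κ₀ η : ℝ} {f : ℂ → ℂ} {x₀ s hmax R Hs : ℝ} {B k : ℕ}
    (hE : EngineHyps5 2 η f x₀ s hmax R Hs B) (hk : ∃ p : ℂ × ℂ, BetaWitnessQ κ₀ η f x₀ s hmax R Hs B k p)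
    (hne : iteratedDeriv (k + 1) f ≠ 0) (hall : ChildrenCarryAll κ₀ η f x₀ s hmax R Hs B k) :
    touchEnergyQ η f x₀ s hmax R Hs B (k + 1) ≤ heldEnergyQ κ₀ η f x₀ s hmax R Hs B (k + 1) := by
  obtain ⟨u₁, u₂, h12, h₁, h₂, hcarry⟩ := hall (Classical.choose hk) (Classical.choose_spec hk)
  exact touchEnergyQ_le_heldEnergyQ_of_children hE hk hne h12 h₁ h₂ hcarry

/-- ★★ (K) choose-free CHILDREN CASE OF Γ3″: β-witnesses at `k` and `k + 1`, the all-pairs children datum at `k`, held energy within `2Hs²`, `0 < cF F`,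
`0 ≤ L` ⇒ `touchRiseHQ k = dropPenaltyHQ k`. -/
theorem touchRiseHQ_eq_penalty_of_all {cF : Budget} {L κ₀ η : ℝ} {f : ℂ → ℂ} {x₀ s hmax R Hs : ℝ} {B k : ℕ}
    (hE : EngineHyps5 2 η f x₀ s hmax R Hs B) (hc : 0 < cF η f x₀ s hmax R Hs B) (hL : 0 ≤ L)
    (hk : ∃ p : ℂ × ℂ, BetaWitnessQ κ₀ η f x₀ s hmax R Hs B k p) (hk1 : ∃ p : ℂ × ℂ, BetaWitnessQ κ₀ η f x₀ s hmax R Hs B (k + 1) p)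
    (hall : ChildrenCarryAll κ₀ η f x₀ s hmax R Hs B k) (hcap : heldEnergyQ κ₀ η f x₀ s hmax R Hs B (k + 1) ≤ 2 * Hs ^ 2) :
    touchRiseHQ cF L κ₀ η f x₀ s hmax R Hs B k = dropPenaltyHQ κ₀ η f x₀ s hmax R Hs B k := by
  obtain ⟨u₁, u₂, h12, h₁, h₂, hcarry⟩ := hall (Classical.choose hk) (Classical.choose_spec hk)
  exact touchRiseHQ_eq_penalty_of_children hE hc hL hk hk1 h12 h₁ h₂ hcarry hcap

end RhW08.TouchedGlueHChildAll
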